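import Summits.QuantumFields.YangMills.Theorems.FluctuationComparisonRegPrIntLS1aAlphaMemOfContinuousVersion
import Summits.QuantumFields.YangMills.Theorems.FluctuationComparisonRegPrIntLS1aTowerLawSandwich
import Literature.MathematicalPhysics.QuantumFieldTheory.Balaban1983to89.T3TiltDescent
import HarnessLib

/-!
# S1a · UV3-NODE §69.15 — THE (w)-READING JUNCTION AND THE `MemOfRun` SHAPE: for the run system of S1aᴴ (`ν K K = Gibbs_K`, `ν K j = (descend)_* ν K (j+1)`) and ANY
# everywhere-continuous non-negative density `ρ` of `ν K n` (px20 g22 ✓p826598's `ρ n`), `ρ` read on run `K` is a.e. `Z_K⁻¹·ρ^{(K)}_{K−n}` (lit ✓`map_descendTo_restrict_eq_withDensity` +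
# ✓`run_eq_map_descendTo`, uniqueness of densities), hence the (α)-node delivers `∃ κ, MemOfRun F ℰp hK {prm n with β := β_K} (e^κ·ρ)` — S1aᴴ's (m) conjunct LITERALLY except for
# the (R-β1′) β slot

Cell `ym3-torus` (YM ladder rung R3 = continuum `SU(2)` Yang–Mills on the three-torus — a RUNG: NOT d = 4, NOT infinite volume, NOT a mass gap, NOT Clay).
Width seat «width 8» `ym3-torus-px8` (gen 24), FREE px helper on crux `stmt-QuantumFields-20520`, count-neutral, DEFINITION-FREE, default heartbeats.

WHAT (0 `def`, 0 `sorry`; nothing of Bałaban's asserted).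
§1 ★★ `ae_eq_inv_partitionFn_mul_resDensity_of_law` — if `ν K n = map (descendTo F ℰp n K hK) (gibbsK F ℰp γ K)` has the density `ρ ≥ 0` w.r.t. `dU^{(n)}`, then
   `ρ =ᵐ Z_K⁻¹ · heightDensity F γ hK univ` (= `Z_K⁻¹·ρ^{(K)}_{K−n} ∘ fieldShift`); ★★ `readAtLevel_ae_eq_resDensity` — hence `Z_K · readAtLevel F hK ρ =ᵐ[dU^{(K)}_{K−n}] ρ^{(K)}_{K−n}`
   (transport along the measure-preserving level identification).
§2 ★★★ `exists_admissible_schedule_memOfRun` — under `AlphaInputsT3ACFullTriv …` + numerics: ONE admissible height schedule `prm` (at `b₀∕2`) such that for every run system `ν` as in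
   S1aᴴ, every `n ≤ K`, and every continuous `ρ ≥ 0` with `ν K n = dU^{(n)}·(ofReal ∘ ρ)`, the four binders + LF clause at `(K, K−n)` give
   `∃ κ : ℝ, MemOfRun F ℰp hK {prm n with β := β_K} (fun V => Real.exp κ * ρ V)` — `κ = E_{K−n} + log Z_K`.
WHAT THIS FILE IS NOT: the four binders (`hlowc` ⟸ `hPintc`, `hupc`, `hRegClass` δ2-b, `hlfle`) and the LF clause `hlarge` (stated for `ρ` read on run `K`); the β slot `(prm n).β` itself
(= (R-β1′): `MemOfRun … (prm n)` needs `β_n·L^{K−n}` read at the reading, RULING №80); (m) at the CUT heights (§67.3 (m3)); nothing of Bałaban's asserted or proved; 20520 ∕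
`YM3TorusSU2` NOT proved; rung R3 — NOT d = 4, NOT infinite volume, NOT a mass gap, NOT Clay.  Sorry-free, axioms standard.
-/

set_option autoImplicit false

noncomputable section

namespace Summit.QuantumFields.YangMills.Theorems.FluctuationComparisonRegPrIntLS1aAlphaMemOfRunOfAlpha

open MeasureTheory Set
open Literature.MathematicalPhysics.QuantumFieldTheory.Balaban1983to89
open T3ContinuumYM3Torus T3UnitScaleTilt T3UnitLawDensityEML T3RestrictedUnitDensity T3AlphaInputsAC T3AlphaInputsACSchemas T3AlphaInputsACTrivRows BalabanUVClass
open T3TiltDescent (descendTo heightDensity map_descendTo_restrict_eq_withDensity heightDensity_nonneg heightDensity_props)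
open Literature.MathematicalPhysics.QuantumFieldTheory.Balaban1983to89.Missing (partitionFn partitionFn_pos')
open T3LevelShift (fieldShift measurePreserving_fieldShift fieldShift_symm_fieldShift fieldShift_fieldShift_symm)
open T3NestedUnitLaws (descend)
open Summit.QuantumFields.YangMills.Theorems.FluctuationComparisonRegPrIntLS1aTowerLawSandwich (run_eq_map_descendTo)
open Summit.QuantumFields.YangMills.Theorems.FluctuationComparisonRegPrIntLS1aAlphaMemOfContinuousVersion (exists_admissible_schedule_mem_continuousVersion)

variable (F : T3Family) {γ : ℝ}

/-! ## §1 The (w)-reading: a continuous density of `ν K n` read on run `K` is a.e. `Z_K⁻¹ ρ^{(K)}_{K−n}` -/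

/-- ★★ **UNIQUENESS OF THE DENSITY OF THE DESCENDED GIBBS MEASURE**: if `(D_{n,K})_* Gibbs_K = dU^{(n)}·(ofReal ∘ ρ)` with `ρ ≥ 0` measurable, then
`ρ =ᵐ Z_K⁻¹·heightDensity F γ hK univ` (lit ✓`map_descendTo_restrict_eq_withDensity` at `S = univ` + `withDensity_eq_iff_of_sigmaFinite`). [cite: Balaban1985UV3, (2) p.256 and (6) p.257] -/
theorem ae_eq_inv_partitionFn_mul_heightDensity_of_law (hγ : 0 ≤ γ) {n K : ℕ} (hK : n ≤ K)
    {ρ : GaugeField (F.P n) 0 (Matrix.specialUnitaryGroup (Fin 2) ℂ) → ℝ} (hρm : Measurable ρ) (hρ0 : ∀ V, 0 ≤ ρ V)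
    (hlaw : Measure.map (descendTo F ℰp n K hK) (gibbsK F ℰp γ K) =
      (fieldMeasure (F.P n) 0 (Matrix.specialUnitaryGroup (Fin 2) ℂ)).withDensity fun V => ENNReal.ofReal (ρ V)) :
    ρ =ᵐ[fieldMeasure (F.P n) 0 (Matrix.specialUnitaryGroup (Fin 2) ℂ)] fun V =>
      (partitionFn (G := Matrix.specialUnitaryGroup (Fin 2) ℂ) (F.P K) ((F.scheme ℰp γ).β K))⁻¹ * heightDensity F γ hK Set.univ V := by
  haveI : IsProbabilityMeasure (fieldMeasure (F.P n) 0 (Matrix.specialUnitaryGroup (Fin 2) ℂ)) := Missing.isProbabilityMeasure_fieldMeasure (F.P n) 0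
  have hZ : 0 < partitionFn (G := Matrix.specialUnitaryGroup (Fin 2) ℂ) (F.P K) ((F.scheme ℰp γ).β K) :=
    partitionFn_pos' _ (F.scheme_β_nonneg ℰp hγ K)
  have h2 := map_descendTo_restrict_eq_withDensity F hK (S := Set.univ) MeasurableSet.univ hγ
  rw [Measure.restrict_univ, hlaw] at h2
  obtain ⟨hdm, -⟩ := heightDensity_props F hK (S := Set.univ) MeasurableSet.univ hγ
  have hae := (withDensity_eq_iff_of_sigmaFinite (ENNReal.measurable_ofReal.comp hρm).aemeasurable
    (ENNReal.measurable_ofReal.comp (hdm.const_mul _)).aemeasurable).1 h2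
  filter_upwards [hae] with V hV
  have h0 : 0 ≤ (partitionFn (G := Matrix.specialUnitaryGroup (Fin 2) ℂ) (F.P K) ((F.scheme ℰp γ).β K))⁻¹ * heightDensity F γ hK Set.univ V :=
    mul_nonneg (inv_nonneg.2 hZ.le) (heightDensity_nonneg F γ hK Set.univ V)
  exact (ENNReal.ofReal_eq_ofReal_iff (hρ0 V) h0).1 hV

/-- ★★ **THE READING ON RUN `K`**: under the same hypothesis, `Z_K · readAtLevel F hK ρ =ᵐ[dU^{(K)}_{K−n}] ρ^{(K)}_{K−n}` (`readAtLevel` and `heightDensity` read through the two inverse level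
identifications; product Haar is preserved). [cite: Balaban1985UV3, (2) p.256 and (6) p.257] -/
theorem readAtLevel_ae_eq_resDensity (hγ : 0 ≤ γ) {n K : ℕ} (hK : n ≤ K)
    {ρ : GaugeField (F.P n) 0 (Matrix.specialUnitaryGroup (Fin 2) ℂ) → ℝ} (hρm : Measurable ρ) (hρ0 : ∀ V, 0 ≤ ρ V)
    (hlaw : Measure.map (descendTo F ℰp n K hK) (gibbsK F ℰp γ K) =
      (fieldMeasure (F.P n) 0 (Matrix.specialUnitaryGroup (Fin 2) ℂ)).withDensity fun V => ENNReal.ofReal (ρ V)) :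
    (fun W => partitionFn (G := Matrix.specialUnitaryGroup (Fin 2) ℂ) (F.P K) ((F.scheme ℰp γ).β K) * readAtLevel F hK ρ W)
      =ᵐ[fieldMeasure (F.P K) (K - n) (Matrix.specialUnitaryGroup (Fin 2) ℂ)] resDensity F γ K Set.univ (K - n) := by
  have hZ : 0 < partitionFn (G := Matrix.specialUnitaryGroup (Fin 2) ℂ) (F.P K) ((F.scheme ℰp γ).β K) :=
    partitionFn_pos' _ (F.scheme_β_nonneg ℰp hγ K)
  have hae := ae_eq_inv_partitionFn_mul_heightDensity_of_law F hγ hK hρm hρ0 hlaw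
  -- transport along `fieldShift (heightShift_eq F hK) : GaugeField (F.P K) (K − n) → GaugeField (F.P n) 0`, which preserves product Haar
  have hmp := measurePreserving_fieldShift (F := F) (G := Matrix.specialUnitaryGroup (Fin 2) ℂ) (heightShift_eq F hK)
  have hcomp := hmp.quasiMeasurePreserving.ae_eq_comp hae
  filter_upwards [hcomp] with W hW
  simp only [Function.comp] at hW
  rw [readAtLevel_apply, hW, ← mul_assoc, mul_inv_cancel₀ hZ.ne', one_mul]
  -- `heightDensity (fieldShift _ W) = ρ^{(K)}_{K−n} (fieldShift _ (fieldShift _ W)) = ρ^{(K)}_{K−n} W`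
  show resDensity F γ K Set.univ (K - n) (fieldShift _ (fieldShift _ W)) = _
  rw [T3LevelShift.fieldShift_fieldShift, T3LevelShift.fieldShift_refl]

/-! ## §2 The `MemOfRun` shape of S1aᴴ's (m) conjunct from the (α)-node -/

/-- ★★★ **S1aᴴ (m) FROM THE (α)-NODE, UP TO THE (R-β1′) β SLOT**: under the package `AlphaInputsT3ACFullTriv …` and the numerics there is ONE admissible height schedule `prm`
(at `b₀∕2`) such that, for every run system `ν` of S1aᴴ (`ν K K = Gibbs_K`, `ν K j = (descend)_* ν K (j+1)`), every `n ≤ K`, and every continuous `ρ ≥ 0` with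
`ν K n = dU^{(n)}·(ofReal ∘ ρ)`, the four displayed binders and the large-field clause at `(K, K−n)` (the latter two stated for `ρ` read on run `K`) give
`∃ κ, MemOfRun F ℰp hK {prm n with β := β_K} (e^κ·ρ)`, `κ = E_{K−n} + log Z_K`. [cite: Balaban1985UV3, (41)-(47) pp.266-267, (2) p.256, (6) p.257] -/
theorem exists_admissible_schedule_memOfRun {D : AlphaDataT3 F γ} (W : LFData D) {b₀ p₀ ε₀ C68 Cχ B₃ r CD R₀ C₅ : ℝ} {M₁ : ℕ}
    (h : AlphaInputsT3ACFullTriv D W b₀ p₀ ε₀ C68 Cχ B₃ M₁ r CD) (hγ : 0 < γ) (hγ1 : γ ≤ 1) (hγe : Real.sqrt γ ≤ Real.exp (1 - p₀)) (hb : 0 ≤ b₀) (hp : 0 ≤ p₀)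
    (hr : 0 ≤ r) (hM1 : 1 ≤ M₁) (hMdvd : M₁ ∣ 2 * F.L ^ F.m) (hCD : 0 ≤ CD) (hR₀ : 0 < R₀) :
    ∃ prm : ℕ → ClassParams, AdmissibleClassParams F γ (b₀ / 2) p₀ prm ∧
      (∀ n, (prm n).δ = θBal F.L γ b₀ p₀ n ∧ (prm n).δreg = R₀ ∧ (prm n).δL = θBal F.L γ b₀ p₀ n ∧ (prm n).β = (F.L : ℝ) ^ n / γ ∧
        (prm n).cLF = B10.pFun (b₀ / 2) p₀ (Real.sqrt (γ * ((F.L : ℝ)⁻¹) ^ n)) ^ 2 / 4 ∧ (prm n).c5 = C₅ ∧ (prm n).cE = 0) ∧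
      ∀ (ν : ℕ → (j : ℕ) → Measure (GaugeField (F.P j) 0 (Matrix.specialUnitaryGroup (Fin 2) ℂ))),
        (∀ K, ν K K = T4GenFunBounds.gibbsMeasure (F.P K) ((F.scheme ℰp γ).β K)) →
        (∀ K j, j < K → ν K j = Measure.map (descend F ℰp j) (ν K (j + 1))) →
        ∀ (K n : ℕ) (hK : n ≤ K) (ρ : GaugeField (F.P n) 0 (Matrix.specialUnitaryGroup (Fin 2) ℂ) → ℝ),
          Continuous ρ → (∀ V, 0 ≤ ρ V) →
          ν K n = (fieldMeasure (F.P n) 0 (Matrix.specialUnitaryGroup (Fin 2) ℂ)).withDensity (fun V => ENNReal.ofReal (ρ V)) →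
          ContinuousOn (D.low K (K - n)) {V | PlaqSmall (θBal F.L γ b₀ p₀ n) V} →
          ContinuousOn (D.up K (K - n)) {V | PlaqSmall (θBal F.L γ b₀ p₀ n) V} →
          (∀ V : GaugeField (F.P K) (K - n) (Matrix.specialUnitaryGroup (Fin 2) ℂ), PlaqSmall (θBal F.L γ b₀ p₀ n) V →
            IsBackground (fun i => BlockAveraging.blockAvg (P := F.P K) (j := i) ℰp) {U | PlaqSmall R₀ U} (K - n) V (D.Umin K (K - n) (D.triv K (K - n)) V)) →
          (∀ V : GaugeField (F.P K) (K - n) (Matrix.specialUnitaryGroup (Fin 2) ℂ),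
            Real.exp (D.Ecst K (K - n)) * (Real.exp (-(D.Ecst K (K - n)) + D.Rm K (K - n)) * (D.up K (K - n) V - D.low K (K - n) V)) ≤
              Real.exp (-(prm n).cLF) * Real.exp (C₅ * Fintype.card (Site (F.P K) (K - n)))) →
          (∀ (V : GaugeField (F.P K) (K - n) (Matrix.specialUnitaryGroup (Fin 2) ℂ)) (S : Finset (Plaq (F.P K) (K - n))),
            (∀ p ∈ S, θBal F.L γ b₀ p₀ n ≤ GaugeGroup.dist1 (GaugeField.plaqHol V p)) →
              Real.exp (D.Ecst K (K - n)) * (partitionFn (G := Matrix.specialUnitaryGroup (Fin 2) ℂ) (F.P K) ((F.scheme ℰp γ).β K) * readAtLevel F hK ρ V) ≤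
                Real.exp (-((prm n).cLF * S.card)) * Real.exp (C₅ * Fintype.card (Site (F.P K) (K - n)))) →
          ∃ κ : ℝ, MemOfRun F ℰp hK { prm n with β := (F.scheme ℰp γ).β K } (fun V => Real.exp κ * ρ V) := by
  obtain ⟨prm, hadm, hfields, hmem⟩ := exists_admissible_schedule_mem_continuousVersion (F := F) W h hγ hγ1 hγe hb hp hr hM1 hMdvd hCD hR₀
  refine ⟨prm, hadm, hfields, fun ν hν1 hν2 K n hK ρ hc h0 hlawν hlowc hupc hRegClass hlfle hlarge => ?_⟩
  have hZ : 0 < partitionFn (G := Matrix.specialUnitaryGroup (Fin 2) ℂ) (F.P K) ((F.scheme ℰp γ).β K) :=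
    partitionFn_pos' _ (F.scheme_β_nonneg ℰp hγ.le K)
  set Z := partitionFn (G := Matrix.specialUnitaryGroup (Fin 2) ℂ) (F.P K) ((F.scheme ℰp γ).β K) with hZdef
  -- the law of `ν K n` is the descended Gibbs measure
  have hlaw : Measure.map (descendTo F ℰp n K hK) (gibbsK F ℰp γ K) =
      (fieldMeasure (F.P n) 0 (Matrix.specialUnitaryGroup (Fin 2) ℂ)).withDensity (fun V => ENNReal.ofReal (ρ V)) := by
    rw [← run_eq_map_descendTo (F := F) ν hν1 hν2 hK, hlawν]
  -- the continuous version on run `K`: `ρ′ := Z · readAtLevel ρ`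
  haveI : BorelSpace (GaugeField (F.P n) 0 (Matrix.specialUnitaryGroup (Fin 2) ℂ)) := T3OrbitAverage.instBorelSpaceGaugeField
  have hρ'c : Continuous fun W : GaugeField (F.P K) (K - n) (Matrix.specialUnitaryGroup (Fin 2) ℂ) => Z * readAtLevel F hK ρ W :=
    continuous_const.mul (hc.comp (continuous_pi fun _ => continuous_apply _))
  have hρ'ae := readAtLevel_ae_eq_resDensity F hγ.le hK hc.measurable h0 hlaw
  have hKn : K - (K - n) = n := Nat.sub_sub_self hK
  have hm := hmem K (K - n) (Nat.sub_le K n) (fun W => Z * readAtLevel F hK ρ W) hρ'c hρ'ae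
    (by rw [hKn]; exact hlowc) (by rw [hKn]; exact hupc) (by rw [hKn]; exact hRegClass) (by rw [hKn]; exact hlfle) (by rw [hKn]; exact hlarge)
  rw [hKn] at hm
  refine ⟨D.Ecst K (K - n) + Real.log Z, ?_⟩
  -- `MemOfRun … r` is `Mem … (readAtLevel r)`; `e^{E}·(Z·readAtLevel ρ) = readAtLevel (e^{E + log Z}·ρ)`
  have hfun : (fun V => Real.exp (D.Ecst K (K - n)) * (Z * readAtLevel F hK ρ V)) =
      readAtLevel F hK (fun V => Real.exp (D.Ecst K (K - n) + Real.log Z) * ρ V) := by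
    funext V
    rw [readAtLevel_apply, readAtLevel_apply, Real.exp_add, Real.exp_log hZ, mul_assoc]
  show Mem (P := F.P K) (k := K - n) (fun i => BlockAveraging.blockAvg (P := F.P K) (j := i) ℰp) { prm n with β := (F.scheme ℰp γ).β K }
    (readAtLevel F hK (fun V => Real.exp (D.Ecst K (K - n) + Real.log Z) * ρ V))
  rw [← hfun]
  exact hm

end Summit.QuantumFields.YangMills.Theorems.FluctuationComparisonRegPrIntLS1aAlphaMemOfRunOfAlpha

end
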